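/-
Copyright (c) 2026 the pub-hodgecm-mathlib formalisation cell (harness21).  Prover seat hodgecm-mathlib-R90-C10-p04 (g3), SLAB R90-TF, section S1 «Ch. 10∕12 local»,
cell «U4-RAM :182 B_pos (ramified tame)», card (6a-G)(β) (dealer R90-C10-plan (g3) 02:24:16Z, R-S1-28 (3), R-S1-29 (β), seam 02:31:43Z with p07 (g2)'s (G2)-PREP): THE
GAUSS-SPHERE VALUES, FILE 3 «THE VALUE LETTERS OF RECORD» — (T1) the Gauss square `Φ(a)²·X = q⁻¹·μ⁻{|y_w| ≤ 1}²` at the critical level, (T3) the packaged critical letter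
`∃ Φcrit, hΦcritC ∧ hΦcrit`, (T4) the deep letter, (T5) the shallow letter — the four value letters of ★ p864649 `shellLaw_of_values`, crux H413 = `stmt-HodgeConjecture-24833`.
KERNEL module: THEOREMS ONLY (no definition, no named fact, no `sorry`, no instance, no notation).  2026-09-05.
-/
import Summits.HodgeConjecture.HodgeConjecture.Theorems.R90S1BposRamGaussSquareModLetters  -- ★ p864799 (G2)-PREP FILE B (R90-C10-p07 (g2)): `sphere_sq_mul_X_eq` over LETTERS; brings FILE A `R90S1BposRamGaussSquarePrep` (inversion, Fubini swap)
import Summits.HodgeConjecture.HodgeConjecture.Theorems.R90S1BposRamGaussSphereShallow    -- ★ p864720 (6a-G)(α) (G4) (R90-C10-p08 (g2)): the shallow levels vanish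
import Summits.HodgeConjecture.HodgeConjecture.Theorems.R90S1BposRamGaussSphere           -- ★ p864789 (6a) PART 3 §0–§1 (R90-C10-p04 (g2), filed by p02 (g3)): `skew_param_facts`, (G3) `setIntegral_sphere_diteInv_sub_eq_zero_of_le`; brings ★ PART 2 p864693, ★ PART 1 p864401
import Summits.HodgeConjecture.HodgeConjecture.Theorems.R90S1BposRamGaussSphereLetters    -- ★ p864828 (6a-G)(β) FILE 2 (this seat): the letters `hadd hI₁ hI₀ hball` + masses (over ★ PART 2)
import Summits.HodgeConjecture.HodgeConjecture.Theorems.R90S1BposRamGaussSphereFamily     -- ★ p864713 (6a-G)(β) FILE 1 (this seat): norm-class constancy along the base family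
import HarnessLib

/-!
# R90 · S1 ∕ U4Keys leaf (U4f-χ₁-ram-one-pos), BRANCH B, TAME RAMIFIED — (6a-G)(β) FILE 3: THE VALUE LETTERS OF RECORD OF THE LEVEL-ONE SPHERE FIBRE `Φ`
# (T1) `Φ(a)²·X = q⁻¹·μ⁻{|y_w| ≤ 1}²` at `|a_w| = |ϖ|^(m+1)`; (T3) `∃ Φcrit, (Φ = Φcrit on the critical members of the base family) ∧ Φcrit²·X = q⁻¹·μ⁻{|y_w| ≤ 1}²`;
# (T4) deep members: `Φ = 0`; (T5) shallow members: `Φ = 0`   [Keys1984 §4–§5, §7 Thm (2) (d); IrelandRosen1990 Ch. 8 §2; Rogawski1990 §12.2 (2)]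

Cell `pub/hodgecm-mathlib` (D-0151), SLAB R90-TF, section S1 «Ch. 10∕12 local», crux H413 = `stmt-HodgeConjecture-24833` (lane `--supports … --as helper`), route of record
`HCCMUnconditional` (no route verbs); prover seat `hodgecm-mathlib-R90-C10-p04` (g3), card (6a-G)(β) `R90S1BposRamGaussSphereValues` (HEADS 02:29Z).  THEOREMS ONLY; ★-only
imports (no `Lines` import).  NOT THE PAYER of :182 ∕ (S-RT) — these are the four VALUE LETTERS `hΦdeep ∕ hΦcritC ∕ hΦsh ∕ hΦcrit` of ★ p864649
`R90S1BposRamShellLawOfRecord.shellLaw_of_values` (consumer instantiates `c := ⅟2`).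

FRAME (PART 3 ∕ p07 (6e) ∕ p03 (6d-R) bytes): `R := LocalRing L v` (one place `w`, tame ramified `he`, `|2|_w = 1`), `σ := conjLocal`, `R⁻ = skewPart σ`, `μY` a regular additive
Haar measure on `R⁻`, `Ē r := if h : IsUnit r then (((χ₁ h.unit)⁻¹ : ℂˣ) : ℂ) else 0`, `S₁ := {s ∈ R⁻ : |s_w| = exp(−1)}`, **`Φ(a) := ∫_{S₁} Ē(a − s) dμY(s)`**; C-pack letters
`(he) (h2w) (χ₁) (h₁) (hB) (hfixP) {ϖ} (hϖ) {m} (hm : 1 ≤ m) (hcond at |ϖ|^(m+1)) (u₁ hu₁ hχu₁ at |ϖ|^m) (hFε)`; ONE CURRENCY `(piU) (hpiU : ∀ w′, |piU w′| = exp(−1))`,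
`l := Units.map σ piU * piU`, `X := ((χ₁ l : ℂˣ) : ℂ)`, `q := ((Ideal.absNorm v.asIdeal : ℝ) : ℂ)`; base family `a′(t, x) := ↑(l ^ t) * (−(x·σx)·c)` (`σc = c`).
RESULTS.
* §1 (T1) **`sq_setIntegral_sphere_diteInv_sub_mul_eq`** — for EVERY `σ`-fixed `a` with `|a_w| = |ϖ|^(m+1)`: **`Φ(a)^2 * X = q⁻¹ * (μY.real {y | |y_w| ≤ 1})^2`**.  Assembly: p07's
  (G2)-PREP `sphere_sq_mul_X_eq` at `ν := μY.map (mulSkewUnit σ δ hδ).symm`, `δ′ := −δ`, `u := −(a·δ⁻¹)` (★ PART 3 §0 `skew_param_facts`), its letters discharged BY NAME: `hΦ` =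
  PART 2 §1 `setIntegral_sphere_diteInv_sub_eq`, `hadd ∕ hI₁ ∕ hI₀ ∕ hball` = FILE 2, `hX = rfl`; then FILE 2 `measureReal_fixedBall_le_one_eq` (`ν(𝒪⁺) = μY{|y_w| ≤ 1}`).
* §2 (T4) **`sphere_family_deep_eq_zero`** (PART 3 (G3), any `l`, any `c`) and (T5) **`sphere_family_shallow_eq_zero`** (p08 (G4), `σl = l`, `σc = c`) — the letters `hΦdeep`, `hΦsh`.
* §3 (T3) **`exists_sphereCrit_sq_mul_eq`** — `∃ Φcrit, (∀ t x, |a′(t,x)_w| = |ϖ|^(m+1) → Φ(a′(t,x)) = Φcrit) ∧ Φcrit^2 * X = q⁻¹ * (μY.real {y | |y_w| ≤ 1})^2` (FILE 1 (T2) norm-class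
  constancy + (T1); if no member is critical, `Φcrit` is a square root — no parity input).
HONEST LABEL.  HC_CM is proved only modulo the 7 printed citations (2 remaining named inputs: hLiu418 = `stmt-HodgeConjecture-24832`, h413 = `stmt-HodgeConjecture-24833`) until rung 0
closes; count-neutral — this file pays NO socket (:182, (S-RT), A2′ stay OPEN); no printed citation is discharged; REL ≠ ★ ≠ BUILT.

## References
* [Keys1984] D. Keys, *Principal series representations of special unitary groups over local fields*, Compositio Math. 51 (1984), §4–§5, §7 Theorem (2) (d) p. 126.
* [IrelandRosen1990] K. Ireland, M. Rosen, *A Classical Introduction to Modern Number Theory*, GTM 84 (1990), Ch. 8 §2 Prop. 8.2.2 (`g² = ε(−1)q`).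
* [Rogawski1990] J. D. Rogawski, *Automorphic Representations of Unitary Groups in Three Variables*, Ann. of Math. Stud. 123 (1990), §12.2 (2) p. 173.
* [WeilBNT1967] A. Weil, *Basic Number Theory* (1967), Ch. II §5.
-/

set_option autoImplicit false
-- the mandated namespace has the single-problem summit's repeated segment (`HodgeConjecture.HodgeConjecture`)
set_option linter.dupNamespace false

noncomputable section

open NumberField IsDedekindDomain MeasureTheory Measure Topology Set
open scoped NNReal ENNReal
open Literature.NumberTheory Literature.NumberTheory.Automorphic Literature.NumberTheory.Automorphic.UnitaryGroup

namespace Summit.HodgeConjecture.HodgeConjecture.R90.S1.BposRamGaussSphereValues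

open Summit.HodgeConjecture.HodgeConjecture.Cruxes.H413
open Summit.HodgeConjecture.HodgeConjecture.Cruxes.H413.K2E3BranchBSkewUnitSign
open Summit.HodgeConjecture.HodgeConjecture.Cruxes.H413.K2E3BranchBSkewLineIntegrals
open Summit.HodgeConjecture.HodgeConjecture.Cruxes.H413.K2E3BranchBSkewLineCharacterIntegral
open Summit.HodgeConjecture.HodgeConjecture.R90.S1
open Summit.HodgeConjecture.HodgeConjecture.R90.S1.BposSkewBallCharacterTools
open Summit.HodgeConjecture.HodgeConjecture.R90.S1.BposRamFixedUnitsHaar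
open Summit.HodgeConjecture.HodgeConjecture.R90.S1.BposRamSkewSphereByFixedUnits
open Summit.HodgeConjecture.HodgeConjecture.R90.S1.BposRamGaussSphereInner
open Summit.HodgeConjecture.HodgeConjecture.R90.S1.BposRamGaussSphere
open Summit.HodgeConjecture.HodgeConjecture.R90.S1.BposRamGaussSphereLetters
open Summit.HodgeConjecture.HodgeConjecture.R90.S1.BposRamGaussSphereFamily
open Summit.HodgeConjecture.HodgeConjecture.R90.S1.BposRamShellFibres
open Summit.HodgeConjecture.HodgeConjecture.R90.S1.BposRamShellFibresOdd
open Summit.HodgeConjecture.HodgeConjecture.R90.S1.BposRamGaussSquarePrep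
open Summit.HodgeConjecture.HodgeConjecture.R90.S1.BposRamGaussSquareModLetters

variable (L : Type) [Field L] [NumberField L] [IsCMField L] (v : HeightOneSpectrum (𝓞 ↥(maximalRealSubfield L)))
  (w : PlacesOver L v) (hw : IsCMField.complexConj L • w.1 = w.1)

variable [MeasurableSpace (LocalRing L v)] [BorelSpace (LocalRing L v)]
  (μY : Measure ↥(HeisRing.skewPart (conjLocal L (IsCMField.complexConj L) v))) [μY.IsAddHaarMeasure] [μY.Regular]

/-! ## §1 (T1) THE GAUSS SQUARE at the critical level, family-free -/

open scoped Classical in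
include hw in
/-- **(T1) THE GAUSS SQUARE ON THE LEVEL-ONE SPHERE: `Φ(a)² · X = q⁻¹ · μ⁻{|y_w| ≤ 1}²`** for every `σ`-fixed `a ∈ R` at the CRITICAL LEVEL `|a_w| = |ϖ|^(m+1)` (`m + 1 =` the
conductor exponent of `χ₁`), in Branch B (`hB`, hence `hfixP`), sub-branch (R-b) (`hFε`), at a tame ramified place with `|2|_w = 1`; `X = χ₁(σΠ·Π)`, `q = N𝔭_v`.  This is the
quadratic Gauss sum `𝔤² = ε(−1)·q` of the residue field, done with integrals and never evaluated: p07 (g2)'s (G2)-PREP `sphere_sq_mul_X_eq` (inversion invariance on the fixed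
units, the substitution `c′ = c·e`, exact additivity, Fubini, orthogonality) at `ν := μ⁻.map M⁻¹`, `δ′ := −δ`, `u := −a·δ⁻¹`, all its letters discharged by PART 2 §1 (`hΦ`),
FILE 2 (`hadd`, `hI₁`, `hI₀`, `hball`) and `rfl` (`hX`); finally `ν(𝒪⁺) = μ⁻{|y_w| ≤ 1}` (FILE 2).  SIGN-FREE (`χ₁(−1)` cancels). [cite: Keys1984, §4–§5, §7 Theorem (2) (d) p. 126]
[cite: IrelandRosen1990, Ch. 8 §2 Prop. 8.2.2] [cite: WeilBNT1967, Ch. II §5] -/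
theorem sq_setIntegral_sphere_diteInv_sub_mul_eq (he : v.asIdeal.ramificationIdx' w.1.asIdeal ≠ 1) (h2w : Valued.v (2 : w.1.adicCompletion L) = 1)
    (χ₁ : (LocalRing L v)ˣ →* ℂˣ) (h₁ : Continuous fun x => ((χ₁ x : ℂˣ) : ℂ))
    (hB : ∀ u : (LocalRing L v)ˣ, (∀ w' : PlacesOver L v, Valued.v ((u : LocalRing L v) w') = 1) →
      χ₁ (u * Units.map (conjLocal L (IsCMField.complexConj L) v : LocalRing L v →* LocalRing L v) u) = 1)
    (hfixP : ∀ u : (LocalRing L v)ˣ, (∀ w' : PlacesOver L v, Valued.v (((u : LocalRing L v) w') - 1) < 1) →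
      conjLocal L (IsCMField.complexConj L) v (u : LocalRing L v) = u → χ₁ u = 1)
    {ϖ : w.1.adicCompletion L} (hϖ : Valued.v ϖ = WithZero.exp (-1 : ℤ)) {m : ℕ} (hm : 1 ≤ m)
    (hcond : ∀ u : (LocalRing L v)ˣ, (∀ w' : PlacesOver L v, Valued.v (((u : LocalRing L v) w') - 1) ≤ Valued.v ϖ ^ (m + 1)) → χ₁ u = 1)
    (u₁ : (LocalRing L v)ˣ) (hu₁ : ∀ w' : PlacesOver L v, Valued.v (((u₁ : LocalRing L v) w') - 1) ≤ Valued.v ϖ ^ m) (hχu₁ : χ₁ u₁ ≠ 1)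
    (hFε : ∃ a₀ : (LocalRing L v)ˣ, Units.map (conjLocal L (IsCMField.complexConj L) v : LocalRing L v →* LocalRing L v) a₀ = a₀ ∧
      (∀ w' : PlacesOver L v, Valued.v ((a₀ : LocalRing L v) w') = 1) ∧ χ₁ a₀ ≠ 1)
    (piU : (LocalRing L v)ˣ) (hpiU : ∀ w' : PlacesOver L v, Valued.v ((piU : LocalRing L v) w') = WithZero.exp (-1 : ℤ))
    {a : LocalRing L v} (ha : conjLocal L (IsCMField.complexConj L) v a = a) (hav : Valued.v (a w) = Valued.v ϖ ^ (m + 1)) :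
    (∫ s in {s : ↥(HeisRing.skewPart (conjLocal L (IsCMField.complexConj L) v)) | Valued.v ((s : LocalRing L v) w) = WithZero.exp (-1 : ℤ)},
        (fun r : LocalRing L v => if h : IsUnit r then (((χ₁ h.unit)⁻¹ : ℂˣ) : ℂ) else 0) (a - (s : LocalRing L v)) ∂μY) ^ 2 *
        ((χ₁ (Units.map (conjLocal L (IsCMField.complexConj L) v : LocalRing L v →* LocalRing L v) piU * piU) : ℂˣ) : ℂ) =
      (((Ideal.absNorm v.asIdeal : ℝ) : ℂ))⁻¹ *
        ((μY.real {y : ↥(HeisRing.skewPart (conjLocal L (IsCMField.complexConj L) v)) | Valued.v ((y : LocalRing L v) w) ≤ 1} : ℝ) : ℂ) ^ 2 := by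
  -- a skew base point `δ` of order one; `ν := μ⁻.map M⁻¹` is a regular additive Haar measure on `R⁺` (PART 1)
  obtain ⟨s₀, hs₀σ, hs₀v⟩ := exists_skew_valued_eq_exp_neg_one L v w hw he h2w
  have hs₀U : IsUnit s₀ := K2E3DepthZeroIwahoriCharacterCM.isUnit_of_apply_ne_zero L v w hw s₀
    (fun h => by rw [h, map_zero] at hs₀v; exact WithZero.zero_ne_coe hs₀v)
  have hδ : conjLocal L (IsCMField.complexConj L) v (hs₀U.unit : LocalRing L v) = -(hs₀U.unit : LocalRing L v) := by rw [IsUnit.unit_spec]; exact hs₀σ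
  have hδv : Valued.v ((hs₀U.unit : LocalRing L v) w) = WithZero.exp (-1 : ℤ) := by rw [IsUnit.unit_spec]; exact hs₀v
  haveI := isAddHaarMeasure_map_mulSkewUnit_symm L v μY hs₀U.unit hδ
  haveI := regular_map_mulSkewUnit_symm L v μY hs₀U.unit hδ
  -- the skew parameter `u := −a·δ⁻¹` of level `|ϖ|ᵐ` (PART 3 §0) and the skew unit `δ′ := −δ`
  obtain ⟨hu, huv⟩ := skew_param_facts L v w hs₀U.unit hδ hδv hϖ ha hav
  have hϖ1 : Valued.v ϖ < 1 := by rw [hϖ, ← WithZero.exp_zero, WithZero.exp_lt_exp]; norm_num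
  have hu1 : Valued.v ((-(a * ((hs₀U.unit⁻¹ : (LocalRing L v)ˣ) : LocalRing L v))) w) < 1 := by
    rw [huv]; exact (pow_lt_one_iff (by omega)).2 hϖ1
  have hδ'σ : conjLocal L (IsCMField.complexConj L) v (((-hs₀U.unit : (LocalRing L v)ˣ)) : LocalRing L v) = -(((-hs₀U.unit : (LocalRing L v)ˣ)) : LocalRing L v) := by
    rw [Units.val_neg, map_neg, hδ]
  have hδ'v : Valued.v ((((-hs₀U.unit : (LocalRing L v)ˣ)) : LocalRing L v) w) = WithZero.exp (-1 : ℤ) := by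
    rw [Units.val_neg, Pi.neg_apply, Valuation.map_neg, hδv]
  -- p07 (g2)'s (G2)-PREP with every letter discharged BY NAME (PART 2 §1, FILE 2), then `ν(𝒪⁺) = μ⁻{|y_w| ≤ 1}` (FILE 2)
  have key := sphere_sq_mul_X_eq L v w hw (μY.map (HeisRing.mulSkewUnit (conjLocal L (IsCMField.complexConj L) v) hs₀U.unit hδ).symm) χ₁ h₁ hu1 _ _
    (-hs₀U.unit) piU hB hfixP hFε
    (fun c e _ hc _ he1 => diteInv_one_add_mul_mul_diteInv_eq L v w hw χ₁ hϖ hm hcond huv c e hc he1)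
    (fun e heσ _ he1 => setIntegral_fixedUnits_diteInv_inner_unit_eq L v w hw μY hs₀U.unit hδ χ₁ he h2w h₁ hfixP hϖ hm hcond u₁ hu₁ hχu₁ hu huv e heσ he1)
    (fun e heσ _ helt => setIntegral_fixedUnits_diteInv_inner_ball_eq L v w hw μY hs₀U.unit hδ χ₁ he hϖ hcond huv e heσ helt)
    hδ'σ hδ'v hpiU (setIntegral_sphere_diteInv_sub_eq L v w hw μY χ₁ hs₀U.unit hδ hδv a) rfl
    (measureReal_fixedBall_le_one_eq_absNorm_mul L v w hw μY hs₀U.unit hδ hδv he h2w)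
  rw [measureReal_fixedBall_le_one_eq L v w hw μY hs₀U.unit hδ hδv he h2w] at key
  exact key

/-! ## §2 (T4) the deep letter and (T5) the shallow letter along the base family -/

open scoped Classical in
include hw in
/-- **(T4) THE DEEP LETTER `hΦdeep` (with `Φdeep := 0`): every member `a′ = lᵗ·(−(x·σx)·c)` of the base family at a DEEP level `|a′_w| ≤ |ϖ|^(m+2)` has `Φ(a′) = 0`** — ★ PART 3
(G3) `setIntegral_sphere_diteInv_sub_eq_zero_of_le`, which holds for every `a` (any `l ∈ Rˣ`, any `c ∈ R`; (R-b) `hFε`, conductor `hcond`). [cite: Keys1984, §7 Theorem (2) (d) p. 126] -/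
theorem sphere_family_deep_eq_zero (he : v.asIdeal.ramificationIdx' w.1.asIdeal ≠ 1) (h2w : Valued.v (2 : w.1.adicCompletion L) = 1)
    (χ₁ : (LocalRing L v)ˣ →* ℂˣ) {ϖ : w.1.adicCompletion L} (hϖ : Valued.v ϖ = WithZero.exp (-1 : ℤ)) {m : ℕ}
    (hcond : ∀ u : (LocalRing L v)ˣ, (∀ w' : PlacesOver L v, Valued.v (((u : LocalRing L v) w') - 1) ≤ Valued.v ϖ ^ (m + 1)) → χ₁ u = 1)
    (hFε : ∃ a₀ : (LocalRing L v)ˣ, Units.map (conjLocal L (IsCMField.complexConj L) v : LocalRing L v →* LocalRing L v) a₀ = a₀ ∧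
      (∀ w' : PlacesOver L v, Valued.v ((a₀ : LocalRing L v) w') = 1) ∧ χ₁ a₀ ≠ 1)
    (l : (LocalRing L v)ˣ) (c : LocalRing L v) :
    ∀ (t : ℕ) (x : LocalRing L v),
      Valued.v (((((l ^ t : (LocalRing L v)ˣ)) : LocalRing L v) * (-(x * conjLocal L (IsCMField.complexConj L) v x) * c)) w) ≤ Valued.v ϖ ^ (m + 2) →
      ∫ s in {s : ↥(HeisRing.skewPart (conjLocal L (IsCMField.complexConj L) v)) | Valued.v ((s : LocalRing L v) w) = WithZero.exp (-1 : ℤ)},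
          (fun r : LocalRing L v => if h : IsUnit r then (((χ₁ h.unit)⁻¹ : ℂˣ) : ℂ) else 0)
            ((((l ^ t : (LocalRing L v)ˣ)) : LocalRing L v) * (-(x * conjLocal L (IsCMField.complexConj L) v x) * c) - (s : LocalRing L v)) ∂μY = 0 :=
  fun _ _ hle => setIntegral_sphere_diteInv_sub_eq_zero_of_le L v w hw μY he h2w χ₁ hϖ hcond hFε hle

open scoped Classical in
include hw in
/-- **(T5) THE SHALLOW LETTER `hΦsh`: every member `a′ = lᵗ·(−(x·σx)·c)` of the base family at a SHALLOW level `|ϖ|^(m+1) < |a′_w| ≤ |ϖ|²` has `Φ(a′) = 0`** — p08 (g2)'s (G4)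
`setIntegral_sphere_diteInv_sub_eq_zero_of_shallow` (every `σ`-fixed `a`), the member being `σ`-fixed for a `σ`-fixed unit `l` and a `σ`-fixed `c` (★ (6b) `conjLocal_units_pow_mul_of_fixed`,
`conjLocal_neg_mul_conj_mul_of_fixed`). [cite: Keys1984, §4–§5, §7 Theorem (2) (d) p. 126] [cite: Rogawski1990, §12.2 (2) p. 173] -/
theorem sphere_family_shallow_eq_zero (he : v.asIdeal.ramificationIdx' w.1.asIdeal ≠ 1) (h2w : Valued.v (2 : w.1.adicCompletion L) = 1)
    (χ₁ : (LocalRing L v)ˣ →* ℂˣ) (h₁ : Continuous fun x => ((χ₁ x : ℂˣ) : ℂ))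
    (hfixP : ∀ u : (LocalRing L v)ˣ, (∀ w' : PlacesOver L v, Valued.v (((u : LocalRing L v) w') - 1) < 1) →
      conjLocal L (IsCMField.complexConj L) v (u : LocalRing L v) = u → χ₁ u = 1)
    {ϖ : w.1.adicCompletion L} (hϖ : Valued.v ϖ = WithZero.exp (-1 : ℤ)) {m : ℕ} (hm : 1 ≤ m)
    (hcond : ∀ u : (LocalRing L v)ˣ, (∀ w' : PlacesOver L v, Valued.v (((u : LocalRing L v) w') - 1) ≤ Valued.v ϖ ^ (m + 1)) → χ₁ u = 1)
    (u₁ : (LocalRing L v)ˣ) (hu₁ : ∀ w' : PlacesOver L v, Valued.v (((u₁ : LocalRing L v) w') - 1) ≤ Valued.v ϖ ^ m) (hχu₁ : χ₁ u₁ ≠ 1)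
    (l : (LocalRing L v)ˣ) (hlσ : conjLocal L (IsCMField.complexConj L) v (l : LocalRing L v) = l)
    {c : LocalRing L v} (hcσ : conjLocal L (IsCMField.complexConj L) v c = c) :
    ∀ (t : ℕ) (x : LocalRing L v),
      Valued.v ϖ ^ (m + 1) < Valued.v (((((l ^ t : (LocalRing L v)ˣ)) : LocalRing L v) * (-(x * conjLocal L (IsCMField.complexConj L) v x) * c)) w) →
      Valued.v (((((l ^ t : (LocalRing L v)ˣ)) : LocalRing L v) * (-(x * conjLocal L (IsCMField.complexConj L) v x) * c)) w) ≤ Valued.v ϖ ^ 2 →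
      ∫ s in {s : ↥(HeisRing.skewPart (conjLocal L (IsCMField.complexConj L) v)) | Valued.v ((s : LocalRing L v) w) = WithZero.exp (-1 : ℤ)},
          (fun r : LocalRing L v => if h : IsUnit r then (((χ₁ h.unit)⁻¹ : ℂˣ) : ℂ) else 0)
            ((((l ^ t : (LocalRing L v)ˣ)) : LocalRing L v) * (-(x * conjLocal L (IsCMField.complexConj L) v x) * c) - (s : LocalRing L v)) ∂μY = 0 :=
  fun t x hlo hhi => BposRamGaussSphereShallow.setIntegral_sphere_diteInv_sub_eq_zero_of_shallow L v w hw μY χ₁ he h2w h₁ hfixP hϖ hm hcond u₁ hu₁ hχu₁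
    (conjLocal_units_pow_mul_of_fixed L v l hlσ (conjLocal_neg_mul_conj_mul_of_fixed L v hcσ x) t) hlo hhi

/-! ## §3 (T3) THE PACKAGED CRITICAL LETTER `∃ Φcrit, hΦcritC ∧ hΦcrit` -/

open scoped Classical in
include hw in
/-- **(T3) THE CRITICAL VALUE OF RECORD.**  With `l := Units.map σ piU * piU`, a `σ`-fixed `c`, and the base family `a′(t, x) := ↑(l ^ t) * (−(x·σx)·c)`:
**`∃ Φcrit : ℂ, (∀ t x, |a′(t,x)_w| = |ϖ|^(m+1) → Φ(a′(t,x)) = Φcrit) ∧ Φcrit ^ 2 * X = q⁻¹ * (μY.real {y | |y_w| ≤ 1}) ^ 2`** — the two letters `hΦcritC`, `hΦcrit` of ★ p864649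
`shellLaw_of_values`.  If some member is critical, `Φcrit` is its value: constancy along the family is ★ FILE 1 (T2) (`a′₁∕a′₂` is a NORM, `hB`) and the square is (T1); otherwise
the first conjunct is vacuous and `Φcrit` is any square root of `X⁻¹·q⁻¹·μ⁻{|y_w| ≤ 1}²` (no parity input needed). [cite: Keys1984, §4–§5, §7 Theorem (2) (d) p. 126]
[cite: Rogawski1990, §12.2 (2) p. 173] -/
theorem exists_sphereCrit_sq_mul_eq (he : v.asIdeal.ramificationIdx' w.1.asIdeal ≠ 1) (h2w : Valued.v (2 : w.1.adicCompletion L) = 1)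
    (χ₁ : (LocalRing L v)ˣ →* ℂˣ) (h₁ : Continuous fun x => ((χ₁ x : ℂˣ) : ℂ))
    (hB : ∀ u : (LocalRing L v)ˣ, (∀ w' : PlacesOver L v, Valued.v ((u : LocalRing L v) w') = 1) →
      χ₁ (u * Units.map (conjLocal L (IsCMField.complexConj L) v : LocalRing L v →* LocalRing L v) u) = 1)
    (hfixP : ∀ u : (LocalRing L v)ˣ, (∀ w' : PlacesOver L v, Valued.v (((u : LocalRing L v) w') - 1) < 1) →
      conjLocal L (IsCMField.complexConj L) v (u : LocalRing L v) = u → χ₁ u = 1)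
    {ϖ : w.1.adicCompletion L} (hϖ : Valued.v ϖ = WithZero.exp (-1 : ℤ)) {m : ℕ} (hm : 1 ≤ m)
    (hcond : ∀ u : (LocalRing L v)ˣ, (∀ w' : PlacesOver L v, Valued.v (((u : LocalRing L v) w') - 1) ≤ Valued.v ϖ ^ (m + 1)) → χ₁ u = 1)
    (u₁ : (LocalRing L v)ˣ) (hu₁ : ∀ w' : PlacesOver L v, Valued.v (((u₁ : LocalRing L v) w') - 1) ≤ Valued.v ϖ ^ m) (hχu₁ : χ₁ u₁ ≠ 1)
    (hFε : ∃ a₀ : (LocalRing L v)ˣ, Units.map (conjLocal L (IsCMField.complexConj L) v : LocalRing L v →* LocalRing L v) a₀ = a₀ ∧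
      (∀ w' : PlacesOver L v, Valued.v ((a₀ : LocalRing L v) w') = 1) ∧ χ₁ a₀ ≠ 1)
    (piU : (LocalRing L v)ˣ) (hpiU : ∀ w' : PlacesOver L v, Valued.v ((piU : LocalRing L v) w') = WithZero.exp (-1 : ℤ))
    {c : LocalRing L v} (hcσ : conjLocal L (IsCMField.complexConj L) v c = c) :
    ∃ Φcrit : ℂ,
      (∀ (t : ℕ) (x : LocalRing L v),
        Valued.v ((((((Units.map (conjLocal L (IsCMField.complexConj L) v : LocalRing L v →* LocalRing L v) piU * piU) ^ t : (LocalRing L v)ˣ)) : LocalRing L v) *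
            (-(x * conjLocal L (IsCMField.complexConj L) v x) * c)) w) = Valued.v ϖ ^ (m + 1) →
        ∫ s in {s : ↥(HeisRing.skewPart (conjLocal L (IsCMField.complexConj L) v)) | Valued.v ((s : LocalRing L v) w) = WithZero.exp (-1 : ℤ)},
            (fun r : LocalRing L v => if h : IsUnit r then (((χ₁ h.unit)⁻¹ : ℂˣ) : ℂ) else 0)
              (((((Units.map (conjLocal L (IsCMField.complexConj L) v : LocalRing L v →* LocalRing L v) piU * piU) ^ t : (LocalRing L v)ˣ)) : LocalRing L v) *
                (-(x * conjLocal L (IsCMField.complexConj L) v x) * c) - (s : LocalRing L v)) ∂μY = Φcrit) ∧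
      Φcrit ^ 2 * ((χ₁ (Units.map (conjLocal L (IsCMField.complexConj L) v : LocalRing L v →* LocalRing L v) piU * piU) : ℂˣ) : ℂ) =
        (((Ideal.absNorm v.asIdeal : ℝ) : ℂ))⁻¹ *
          ((μY.real {y : ↥(HeisRing.skewPart (conjLocal L (IsCMField.complexConj L) v)) | Valued.v ((y : LocalRing L v) w) ≤ 1} : ℝ) : ℂ) ^ 2 := by
  obtain ⟨hlσ, -, -⟩ := scalingUnit_letters_conj_mul_ram L v w hw he piU hpiU
  have hϖ0 : Valued.v ϖ ≠ 0 := by rw [hϖ]; exact WithZero.exp_ne_zero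
  by_cases hex : ∃ (t : ℕ) (x : LocalRing L v),
      Valued.v ((((((Units.map (conjLocal L (IsCMField.complexConj L) v : LocalRing L v →* LocalRing L v) piU * piU) ^ t : (LocalRing L v)ˣ)) : LocalRing L v) *
          (-(x * conjLocal L (IsCMField.complexConj L) v x) * c)) w) = Valued.v ϖ ^ (m + 1)
  · obtain ⟨t₀, x₀, h₀⟩ := hex
    refine ⟨_, fun t x htx => setIntegral_sphere_diteInv_sub_family_eq L v w hw μY χ₁ hB piU c t t₀ x x₀ (htx.trans h₀.symm)
      (by rw [htx]; exact pow_ne_zero _ hϖ0), ?_⟩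
    exact sq_setIntegral_sphere_diteInv_sub_mul_eq L v w hw μY he h2w χ₁ h₁ hB hfixP hϖ hm hcond u₁ hu₁ hχu₁ hFε piU hpiU
      (conjLocal_units_pow_mul_of_fixed L v _ hlσ (conjLocal_neg_mul_conj_mul_of_fixed L v hcσ x₀) t₀) h₀
  · -- no critical member: any square root will do
    set X : ℂ := ((χ₁ (Units.map (conjLocal L (IsCMField.complexConj L) v : LocalRing L v →* LocalRing L v) piU * piU) : ℂˣ) : ℂ) with hX
    have hX0 : X ≠ 0 := Units.ne_zero _
    obtain ⟨z, hz⟩ := IsAlgClosed.exists_pow_nat_eq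
      (X⁻¹ * ((((Ideal.absNorm v.asIdeal : ℝ) : ℂ))⁻¹ *
        ((μY.real {y : ↥(HeisRing.skewPart (conjLocal L (IsCMField.complexConj L) v)) | Valued.v ((y : LocalRing L v) w) ≤ 1} : ℝ) : ℂ) ^ 2)) two_pos
    refine ⟨z, fun t x htx => absurd ⟨t, x, htx⟩ hex, ?_⟩
    rw [hz, mul_comm X⁻¹, inv_mul_cancel_right₀ hX0]

end Summit.HodgeConjecture.HodgeConjecture.R90.S1.BposRamGaussSphereValues

end
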